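import Literature.MathematicalPhysics.QuantumFieldTheory.Balaban1983to89.B9Eq3130GtildeTwoBackgroundLetterTower
import Literature.MathematicalPhysics.QuantumFieldTheory.Balaban1983to89.B9Eq3152GtildeThirdWordTwoSided
import Literature.MathematicalPhysics.QuantumFieldTheory.Balaban1983to89.B9Eq325RofUkSupRowClosed
import Literature.MathematicalPhysics.QuantumFieldTheory.Balaban1983to89.B9Eq368TowerProjLadderClosed
import Literature.MathematicalPhysics.QuantumFieldTheory.Balaban1983to89.B9Eq368TowerProjWordGradientLetters
import Literature.MathematicalPhysics.QuantumFieldTheory.Balaban1983to89.B9Eq375BondDivergenceTwoBackgroundLetterTower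

/-!
# `Balaban1983to89.B9Eq3152RkGpDstarPiTwoBackgroundLetterTower` — T. Bałaban, *Propagators for lattice gauge theories in a background field*, Commun. Math. Phys. **99** (1985) 389–434
# [Balaban1985BackgroundPropagators] (3.152)–(3.153) p. 426 *«RD\*G₁ = RG′D\*, and G₁DR = DG′R»*, (3.147) p. 425, (3.122) p. 420, (3.68) p. 403, Thm 3.4 p. 400, Thm 3.1 (3.42) p. 397, (3.8)
# p. 392, with [Balaban1985Variational] (110)–(111) p. 294, (117) p. 295: **THE INNER SITE FUNCTION `ω = R_kG′_kD*_U f` OF THE THIRD WORD `DG′RG′D*` OF PRINT's `𝔊̃_k`,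
# TWO-BACKGROUND LADDER AT THE FLAT BASE, VALUE MEMBER** — for one-block fine-bond sources `f` over the coarse block `v` with `‖f‖_∞ ≤ F` and every fine site `y`:
# `‖(R_k(U)G′_k(U)D*_U f − R_k(1)G′_k(1)D*_1 f)(y)‖ ≤ (j₀ + α)·K·e^{−κ·d_m(Π(y), v)}·F`, constants BEFORE `n, η, m, U` — by (3.152) `R_kG′_kD*_U = R_kD*_UG̃_k` at `U` and at `1`
# (`G̃_k(1) = G_k(1)`), telescoped as `(R_k(U) − R_k(1))D*_UG̃_k(U) + R_k(1)D*_U(G̃_k(U) − G_k(1)) + R_k(1)(D*_U − D*_1)G_k(1)`: gen 100's `R_k` ladder majorant read back as a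
# local letter, the OWNER's (T4B) divergence row of `G̃_k`, gen 101's `∇_U` letter of `G̃_k(U) − G_k(1)` read as a divergence (`D*_UA = −Σ_μ R(U(b))⁻¹(∇_UA)(b, μ)`), gen 100's
# `(D*_U − D*_1)G_k(1)` letter, ne9-leaf-05's `R_k` letter at the vacuum

statement-level skeleton of published theorems with citation tags; proofs where landed; nothing here is a claim about the Yang–Mills mass gap

CITATION HEADER (lean-in-tree rule).  Audit cell `pub-balaban`, sub-cell `t4`, BINDER row NE9; filed by NE9 crux-team LEAF PROVER 01 (`b2b-balaban-t4-ne9-formalise-leaf-01`, gen 102;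
ROUTE (J′), π-side, the `𝔊̃` storey (third word, inner site function); bears_on: R4/N22).  Composition BY NAME: gen 101's `B9Eq3130GtildeTwoBackgroundLetterTower.exists_letters_G1kPi_sub_flat`
(conjunct 2), gen 100's `B9Eq368TowerProjLadderClosed.exists_hasMajorant_RofUk_sub_flat_closed`, `B9Eq375BondDivergenceTwoBackgroundLetterTower.exists_letters_covDiv_G1k_one`,
gen 99's seam `B9Eq342MajorantReadingSeam.blockRowW_of_hasMajorant_conj_readA`, gen 92's `B9Eq3152GtildeThirdWordTwoSided.RofUk_covDivL2K_G1LatticeKPi`; the OWNER's (T4B)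
`B9Eq3130GtildeGradRowClosed.exists_local_rows_G1kPi` (MODEL rows — O-NE9-1, #5 UNRULED); ne9-leaf-05's `B9Eq325RofUkSupRowClosed.exists_local_letters_GpOfUk_RofUk`,
`B9Eq326G1SupRowOfLetters.{letter_comp, letter_add}`; ne9-leaf-03's `B9Eq3119DeltaPiTowerFlat.{laplaceAkPi_one_pos_iff, letters_laplaceAkPi_one}`; ne9-leaf-01's
`B9Eq349BlockMultipliers.exists_block_clm_family`; `B9Eq3101ConjugationLettersChain.norm_adTransportW_le`.  Source READ first-hand in the held text layer
`paper:balaban1985-cmp99-background-propagators` (journal page = PDF page + 388) pp. 392, 397, 400, 403, 420, 425–426.  NOTHING of print's proofs is reproduced: [folklore] telescoping + letter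
compositions (the pattern of gen 101's `B9Eq3153FrakGkPiMiddleWordTwoBackgroundLetterTower`).

WHAT IS PROVED (sorry-free; proof lane — 0 `def`; [folklore]).
* §1 `covDiv_eq_neg_sum_covGrad` — `(D*_SA)(y) = −Σ_μ S(y−e_μ, μ)((∇_RA)((y−e_μ, μ), μ))` whenever `S(b)∘R(b) = 1` (the divergence (3.8) through the covariant gradient (3.3)).
* §2 **`exists_letter_RkGpDstar_sub_flat`** — `∃ α₁ j₁ > 0, K ≥ 0, κ > 0` BEFORE the binder block of `exists_letters_G1kPi_sub_flat` VERBATIM (fine-bond one-block sources `f`, output fine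
  SITES `y`): `‖(R_k(U)G′_k(U)D*_U f − R_k(1)G′_k(1)D*_1 f)(y)‖ ≤ (j₀ + α)·K·e^{−κ·d_m(Π(y),v)}·F` — three words, `letter_comp` each, `letter_add` twice; the owner's α-convention
  rows are called at the radius `max(α, j₀)`.
HONEST SCOPE.  Composition BY NAME on the cell's MODEL rows (O-NE9-1, #5 UNRULED); constants crude; VALUE member only (the gradient member `∇_1` of the third word between two backgrounds needs
η-scale Hölder ∕ Hessian rows of `G′_k` BETWEEN TWO BACKGROUNDS — Thm 3.4 for (3.43)₂∕(3.44) — which are NOT in the tree: LOCATED, not typed); `j₀` and `α` displayed separately; the windows,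
`c₀ = η^d`, unitarity, the tower data, `hαL`, the positivity and onto witnesses stay HYPOTHESES; nothing of [B9] (3.152)–(3.153) ∕ Thm 3.4 or [B11] (117) asserted as printed; «NE9 ⇐ the named
binders»; NE9 NOT PRINTED ∕ NOT PROVED; spine PROVED 0∕9; rung (B)+1 on a finite T⁴ — NOT infinite volume, NOT mass gap, NOT BetaPertH, NOT Clay.  HONEST DEPENDENCY: continuum YM on T⁴ ⇐
BetaPertH ∧ nine spine estimates (0/9 proved); BetaPertH ⇐ (D1) ∧ (D4) ∧ CAP+tail; G-an2-4 gates asym, D1 and NE2/3/4.  NEW file; nothing modified.  Net new unproved facts: 0.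
-/

noncomputable section

open scoped InnerProductSpace ComplexConjugate BigOperators

namespace Literature.MathematicalPhysics.QuantumFieldTheory.Balaban1983to89.B9Eq3152RkGpDstarPiTwoBackgroundLetterTower

open B4Sect5Torus (TSite tdist tdist_nonneg tdist_triangle tdist_symm torusSum_le tdist_self)
open B4Sect5Proof (latticeConst latticeConst_nonneg)
open B9SectCLatticeCarrier (Bond bpos btgt shift unshift shift_unshift)
open B9Eq311L2Pairing (WL2)
open B9Eq319QprimeTorus (blockCoord)
open B7Prop1Explicit (U1 Wcx boxVec)
open B11Eq103H1Complex (SiteL2K BondL2K covDerivL2K covDivL2K G1LatticeK equiv_covDivL2K)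
open B9Eq33CovDerivVector (covGrad covDiv covDiv_apply covGrad_apply_dir)
open B9Eq310DeltaPrime (plaqHolU plaqHolU_one)
open B9Eq310HessianOperator (adTransportW)
open B9Eq315QTorus (perCfg cornerSite)
open B9Eq315QTower (towerP UlevOf)
open B9Eq315QTowerFlat (perCfg_UlevOf_one_mem_U1 norm_Wcx_UlevOf_one_sub_one_le UlevOf_one)
open B9Eq316TowerFlatIsOneStep (towerP_eq_fineP_pow siteCast)
open B9Eq326OperatorTower (QkW laplaceAk G1k RofUk QkW_surjective)
open B9Eq324DeltaPrimeATower (laplacePrimeAk GpOfUk)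
open B9Eq3119DeltaPiTower (laplaceAkPi)
open B9Eq3119DeltaPiTowerFlat (laplaceAkPi_one_pos_iff letters_laplaceAkPi_one)
open B9Eq326G1SupRowOfLetters (letter_comp letter_add)
open B9Eq3130GtildeGradRowClosed (exists_local_rows_G1kPi)
open B9Eq3130GtildeTwoBackgroundLetterTower (exists_letters_G1kPi_sub_flat)
open B9Eq375BondDivergenceTwoBackgroundLetterTower (exists_letters_covDiv_G1k_one)
open B9Eq368TowerProjLadderClosed (exists_hasMajorant_RofUk_sub_flat_closed)
open B9Eq325RofUkSupRowClosed (exists_local_letters_GpOfUk_RofUk)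
open B9Eq3152GtildeThirdWordTwoSided (RofUk_covDivL2K_G1LatticeKPi)
open B9Eq342MajorantReadingSeam (blockRowW_of_hasMajorant_conj_readA)
open B9Eq352DivFormLetters (conj_sub)
open B9Eq324PenaltyKernelForm (readA_sub)
open B9Eq341TowerBlockGeometry (towerGeom dist_towerGeom blkK_eq_blockCoord_siteCast)
open B9Eq357QprimeTowerKernelForm (blkK)
open B9Thm34Ext (toB6)
open B9Eq368TowerProjWordGradientLetters (tdist_le_tdist1)
open B9Eq349BlockMultipliers (exists_block_clm_family)
open B9Eq3101ConjugationLettersChain (norm_adTransportW_le)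

/-! ## §1 The divergence through the covariant gradient -/

/-- **`(D*_SA)(y) = −Σ_μ S(y−e_μ,μ)((∇_RA)((y−e_μ,μ),μ))` when `S(b)∘R(b) = 1`** — (3.8) read through (3.3) on the components: the bond `b = ⟨y−e_μ, y⟩` carries the component `μ` of
`∇_RA` at `b`, transported back by `S(b) = R(b)⁻¹`. [folklore] [cite: Balaban1985BackgroundPropagators, (3.8) p.392, (3.3) p.391] -/
theorem covDiv_eq_neg_sum_covGrad {d : ℕ} {P : Fin d → ℕ} {V : Type*} [AddCommGroup V] [Module ℂ V] (c : ℂ) (R S : Bond d P → V →ₗ[ℂ] V)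
    (hSR : ∀ b v, S b (R b v) = v) (A : Bond d P → V) (y : TSite d P) :
    covDiv c S A y = -∑ μ, S (unshift μ y, μ) (covGrad c R A ((unshift μ y, μ), μ)) := by
  rw [covDiv_apply, Finset.smul_sum, ← Finset.sum_neg_distrib]
  refine Finset.sum_congr rfl fun μ _ => ?_
  rw [covGrad_apply_dir, shift_unshift]
  simp only [map_smul, map_sub, hSR, smul_sub, neg_sub]

/-! ## §2 The two-background letter of `ω = R_kG′_kD*_U f`, value member -/

variable {d : ℕ} (hd : 1 ≤ d) (L : ℕ) [NeZero L] (hL : 1 ≤ L) (hL3 : 3 ≤ L)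
  {𝔸 : Type*} [NormedRing 𝔸] [NormedAlgebra ℂ 𝔸] [CompleteSpace 𝔸] [NormOneClass 𝔸] [StarRing 𝔸] [NormedStarGroup 𝔸] [StarModule ℂ 𝔸] [FiniteDimensional ℂ 𝔸]
  {W : Type*} [NormedAddCommGroup W] [InnerProductSpace ℂ W] [FiniteDimensional ℂ W] (φ : W ≃ₗ[ℂ] 𝔸)
  {Mφ Mφ' : ℝ} (hMφ : 0 ≤ Mφ) (hMφ' : 0 ≤ Mφ') (hφ : ∀ w, ‖φ w‖ ≤ Mφ * ‖w‖) (hφ' : ∀ X, ‖φ.symm X‖ ≤ Mφ' * ‖X‖) (hstar : ∀ X : 𝔸, ‖star X‖ ≤ ‖X‖)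
  {a : ℝ} (ha : 0 < a) {a' : ℝ} (ha' : 0 < a') {ϱ : ℝ} (hϱ0 : 0 ≤ ϱ) (hϱ1 : ϱ < 1)
  (τ : 𝔸 →ₗ[ℂ] ℂ) {Cτ : ℝ} (hτ : ∀ X, ‖τ X‖ ≤ Cτ * ‖X‖) (hCτ : 0 ≤ Cτ) {Mτ : ℝ} (hτm : ∀ X Y : 𝔸, ‖τ (X * Y)‖ ≤ Mτ * ‖X‖ * ‖Y‖) (hMτ : 0 ≤ Mτ)
  {ρw : ℝ} (hρw : 0 ≤ ρw)
  (hτ₁ : ∀ X : 𝔸, τ (star X) = conj (τ X)) (hτ₂ : ∀ X Y : 𝔸, τ (X * Y) = τ (Y * X)) (hφτ : ∀ X Y : 𝔸, ⟪φ.symm X, φ.symm Y⟫_ℂ = τ (star X * Y))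
  (AQ : ℝ)
  {ι : Type} [Fintype ι] [DecidableEq ι] (b : Module.Basis ι ℝ 𝔸) {M₂ : ℝ} (hM₂ : 0 ≤ M₂) (hrepr : ∀ (v : 𝔸) (i : ι), |b.repr v i| ≤ M₂ * ‖v‖)

include hd hL hL3 hMφ hMφ' hφ hφ' hstar ha ha' hϱ0 hϱ1 hτ hCτ hτm hMτ hρw hτ₁ hτ₂ hφτ hM₂ hrepr in
set_option maxHeartbeats 3200000 in
set_option maxRecDepth 8192 in
/-- **THE INNER SITE FUNCTION `ω = R_kG′_kD*_U f` OF THE THIRD WORD, TWO-BACKGROUND LADDER AT THE FLAT BASE, VALUE MEMBER** — see the module docstring. [folklore]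
[cite: Balaban1985BackgroundPropagators, (3.152)–(3.153) p.426, (3.147) p.425, (3.122) p.420, (3.68) p.403, Thm 3.4 p.400, (3.8) p.392; Balaban1985Variational, (110)–(111) p.294, (117) p.295] -/
theorem exists_letter_RkGpDstar_sub_flat :
    ∃ α₁ j₁ K κ : ℝ, 0 < α₁ ∧ 0 < j₁ ∧ 0 ≤ K ∧ 0 < κ ∧
      ∀ (n : ℕ) (η : ℝ) (_hηL : η * (L : ℝ) ^ (n + 1) = 1) (c₀ c₁ : ℝ) [Fact (0 < c₀)] [Fact (0 < c₁)]
        (_hw : c₀ * ((L : ℝ) ^ (n + 1)) ^ d = c₁) (_hρ : |η| ^ d / c₀ ≤ ρw) (m : Fin d → ℕ) [∀ i, NeZero (m i)] (_hm : ∀ i, 1 ≤ m i)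
        (U : Bond d (towerP L m (n + 1)) → 𝔸ˣ) (αU : ℕ → ℝ) (_hα0 : ∀ j, 0 ≤ αU j) (hα1 : ∀ j, αU j ≤ 1 / 64)
        (_hαL : ∀ j, 50 * (d + 1) * αU j * (L : ℝ) ^ d ≤ 1 / 2)
        (hU1 : ∀ (j : ℕ) (x : B7Prop1Explicit.Site d) (k : Fin d), perCfg (towerP L m (j + 1)) (UlevOf L m (n + 1) U j) x k ∈ U1 𝔸)
        (hreg : ∀ (j : ℕ) (y : TSite d (towerP L m j)) (k : Fin d) (ρ' : Fin d → Fin L),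
          ‖((Wcx L (perCfg (towerP L m (j + 1)) (UlevOf L m (n + 1) U j)) (cornerSite L y) k (boxVec L ρ') : 𝔸ˣ) : 𝔸) - 1‖ ≤ αU j)
        (εU : ℕ → ℝ) (_hεU : ∀ j, 0 ≤ εU j) (_hε1 : ∀ j, εU j ≤ 1) (_hUε : ∀ (j : ℕ) (b : Bond d (towerP L m (j + 1))), ‖(UlevOf L m (n + 1) U j b : 𝔸) - 1‖ ≤ εU j)
        (_hLb : ∀ (j : ℕ) (b : Bond d (towerP L m (j + 1))), UlevOf L m (n + 1) U j b ∈ U1 𝔸)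
        (α : ℝ) (_hα : 0 ≤ α) (_hαle : α ≤ α₁)
        (hUst : ∀ b, star (U b : 𝔸) = (((U b)⁻¹ : 𝔸ˣ) : 𝔸)) (_hUb : ∀ b, U b ∈ U1 𝔸) (_hUη : ∀ b, ‖(U b : 𝔸) - 1‖ ≤ α * η)
        (_hUw : ∀ (x : TSite d (towerP L m (n + 1))) (μ ν : Fin d), ‖(U (shift ν x, μ) : 𝔸) - (U (x, μ) : 𝔸)‖ ≤ α * η ^ 2)
        (_hpl : ∀ p : B9SectCLatticeCarrier.Plaq d (towerP L m (n + 1)), ‖(plaqHolU U p : 𝔸) - 1‖ ≤ α * η ^ 2)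
        (_hUgrad : ∀ (x : TSite d (towerP L m (n + 1))) (μ : Fin d), ‖(U (x, μ) : 𝔸) - U (unshift μ x, μ)‖ ≤ α * η ^ 2)
        (_hRlev : ∀ (j : ℕ) (b : Bond d (towerP L m (j + 1))) (w : W), ‖adTransportW φ (UlevOf L m (n + 1) U j) b w‖ ≤ ‖w‖)
        (_hεg : ∀ j < n + 1, εU j ≤ α * ϱ ^ j) (_hAQ : ∑ j ∈ Finset.range (n + 1), αU j ≤ AQ)
        (hpos' : ∀ x : SiteL2K ℂ d (towerP L m (n + 1)) c₀ W, x ≠ 0 → 0 < RCLike.re ⟪x, laplacePrimeAk L m n φ η U a' (c₁ := c₁) x⟫_ℂ)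
        (hpos : ∀ x : BondL2K ℂ d (towerP L m (n + 1)) c₀ W, x ≠ 0 →
          0 < RCLike.re ⟪x, laplaceAk L m n φ η U hL αU hα1 hU1 hreg τ (c₀ := c₀) (c₁ := c₁) a x⟫_ℂ)
        (_hc₀η : c₀ = η ^ d) (j₀ : ℝ) (_hJ : ∀ μ y, ‖B9Eq39Adjoint.J (fun μ => B9Eq33CovDerivVector.shiftEquiv μ) (fun μ y => U (y, μ)) η μ y‖ ≤ j₀) (_hj : j₀ ≤ j₁)
        (hposπ : ∀ x : BondL2K ℂ d (towerP L m (n + 1)) c₀ W, x ≠ 0 →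
          0 < RCLike.re ⟪x, laplaceAkPi L m n φ τ η U a' hpos' hL αU hα1 hU1 hreg (c₁ := c₁) a x⟫_ℂ)
        (_hQ : Function.Surjective (QkW L m n φ U hL αU hα1 hU1 hreg (c₀ := c₀) (c₁ := c₁)))
        (hpos'₁ : ∀ x : SiteL2K ℂ d (towerP L m (n + 1)) c₀ W, x ≠ 0 →
          0 < RCLike.re ⟪x, laplacePrimeAk L m n φ η (fun _ : Bond d (towerP L m (n + 1)) => (1 : 𝔸ˣ)) a' (c₁ := c₁) x⟫_ℂ)
        (hpos₁ : ∀ x : BondL2K ℂ d (towerP L m (n + 1)) c₀ W, x ≠ 0 →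
          0 < RCLike.re ⟪x, laplaceAk L m n φ η (fun _ : Bond d (towerP L m (n + 1)) => (1 : 𝔸ˣ)) hL (fun _ => 0) (fun _ => by norm_num)
            (perCfg_UlevOf_one_mem_U1 L m (n + 1)) (norm_Wcx_UlevOf_one_sub_one_le L m (n + 1) (fun _ => 0) (fun _ => le_rfl)) τ
            (c₀ := c₀) (c₁ := c₁) a x⟫_ℂ)
        (v : TSite d m) (f : BondL2K ℂ d (towerP L m (n + 1)) c₀ W) (F : ℝ)
        (_hfv : ∀ b', blockCoord (L ^ (n + 1)) m (siteCast (towerP_eq_fineP_pow L m (n + 1)) (bpos b')) ≠ v → WL2.equiv ℂ (fun _ : Bond d (towerP L m (n + 1)) => c₀) W f b' = 0)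
        (_hfF : ∀ b', ‖WL2.equiv ℂ (fun _ : Bond d (towerP L m (n + 1)) => c₀) W f b'‖ ≤ F) (y : TSite d (towerP L m (n + 1))),
        ‖WL2.equiv ℂ (fun _ : TSite d (towerP L m (n + 1)) => c₀) W
            (RofUk L m n φ η U (c₀ := c₀) (GpOfUk L m n φ η U a' (c₁ := c₁) hpos' (covDivL2K ℂ c₀ ((η : ℂ))⁻¹ (adTransportW φ fun bb => (U bb)⁻¹) f)) -
              RofUk L m n φ η (fun _ : Bond d (towerP L m (n + 1)) => (1 : 𝔸ˣ)) (c₀ := c₀)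
                (GpOfUk L m n φ η (fun _ : Bond d (towerP L m (n + 1)) => (1 : 𝔸ˣ)) a' (c₁ := c₁) hpos'₁
                  (covDivL2K ℂ c₀ ((η : ℂ))⁻¹ (adTransportW φ fun bb => ((fun _ : Bond d (towerP L m (n + 1)) => (1 : 𝔸ˣ)) bb)⁻¹) f))) y‖ ≤
          (j₀ + α) * K * Real.exp (-(κ * tdist m (blockCoord (L ^ (n + 1)) m (siteCast (towerP_eq_fineP_pow L m (n + 1)) y)) v)) * F := by
  classical
  -- (0) the suppliers, `∃`-first
  obtain ⟨αT, BT, δT, hαT, hBT, hδT, HT⟩ :=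
    exists_local_rows_G1kPi hd L hL hL3 φ hMφ hMφ' hφ hφ' hstar ha ha' hϱ0 hϱ1 τ hτ hCτ hτm hMτ hρw hτ₁ hτ₂ hφτ AQ
  obtain ⟨αP, jP, KP, κP, hαP, hjP, hKP, hκP, HP⟩ :=
    exists_letters_G1kPi_sub_flat hd L hL hL3 φ hMφ hMφ' hφ hφ' hstar ha ha' hϱ0 hϱ1 τ hτ hCτ hτm hMτ hρw hτ₁ hτ₂ hφτ AQ b hM₂ hrepr
  obtain ⟨αW, KW, κW, hαW, hKW, hκW, HW⟩ :=
    exists_letters_covDiv_G1k_one hd L hL hL3 φ hMφ hMφ' hφ hφ' hstar ha ha' τ hτ hCτ hτm hMτ hρw hτ₁ hτ₂ hφτ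
  obtain ⟨αR, KR, δR, hαR, hKR, hδR, HR⟩ :=
    exists_hasMajorant_RofUk_sub_flat_closed L φ hMφ hMφ' hφ hφ' ha ha' hϱ0 hϱ1 τ hτ hCτ hρw hτ₁ hτ₂ hφτ hMτ b hM₂ hrepr hd hL hL3
  obtain ⟨αO, BO, δO, hαO, hBO, hδO, HO⟩ :=
    exists_local_letters_GpOfUk_RofUk hd L hL hL3 φ hMφ hMφ' hφ hφ' ha ha' hϱ0 hϱ1 τ hτ hCτ hMτ hρw hτ₁ hτ₂ hφτ AQ
  set κ₀ : ℝ := min (min δT κP) (min κW (min δR δO)) with hκ₀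
  have hκ₀0 : 0 < κ₀ := lt_min (lt_min hδT hκP) (lt_min hκW (lt_min hδR hδO))
  have hκ₀T : κ₀ ≤ δT := (min_le_left _ _).trans (min_le_left _ _)
  have hκ₀P : κ₀ ≤ κP := (min_le_left _ _).trans (min_le_right _ _)
  have hκ₀W : κ₀ ≤ κW := (min_le_right _ _).trans (min_le_left _ _)
  have hκ₀R : κ₀ ≤ δR := (min_le_right _ _).trans ((min_le_right _ _).trans (min_le_left _ _))
  have hκ₀O : κ₀ ≤ δO := (min_le_right _ _).trans ((min_le_right _ _).trans (min_le_right _ _))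
  set S : ℝ := latticeConst d (κ₀ / 2) with hS
  have hS0 : 0 ≤ S := latticeConst_nonneg d (half_pos hκ₀0).le
  have hSb : 0 ≤ ∑ i, ‖b i‖ := Finset.sum_nonneg fun i _ => norm_nonneg _
  set KR' : ℝ := Mφ' * Mφ * ((∑ i, ‖b i‖) * M₂ * KR) with hKR'
  have hKR'0 : 0 ≤ KR' := by positivity
  set KD : ℝ := (d : ℝ) * (Mφ * Mφ') * KP with hKD
  have hKD0 : 0 ≤ KD := by positivity
  set K : ℝ := BT * KR' * S + KD * BO * S + KW * BO * S with hK
  have hK0 : 0 ≤ K := by positivity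
  refine ⟨min (min αT αP) (min αW (min αR 1)), min αT jP, K, κ₀ / 2,
    lt_min (lt_min hαT hαP) (lt_min hαW (lt_min hαR one_pos)), lt_min hαT hjP, hK0, half_pos hκ₀0, ?_⟩
  intro n η hηL c₀ c₁ _ _ hw hρ m _ hm U αU hα0 hα1 hαL hU1 hreg εU hεU hε1 hUε hLb α hα hαle hUst hUb hUη hUw hpl hUgrad hRlev hεg hAQ hpos' hpos hc₀η j₀ hJ hj
    hposπ hQ hpos'₁ hpos₁ v f F hfv hfF y
  have hαT' : α ≤ αT := hαle.trans ((min_le_left _ _).trans (min_le_left _ _))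
  have hαP' : α ≤ αP := hαle.trans ((min_le_left _ _).trans (min_le_right _ _))
  have hαW' : α ≤ αW := hαle.trans ((min_le_right _ _).trans (min_le_left _ _))
  have hαR' : α ≤ αR := hαle.trans ((min_le_right _ _).trans ((min_le_right _ _).trans (min_le_left _ _)))
  have hjT' : j₀ ≤ αT := hj.trans (min_le_left _ _)
  have hjP' : j₀ ≤ jP := hj.trans (min_le_right _ _)
  have hc₀ : (0 : ℝ) < c₀ := Fact.out
  haveI : Nonempty (Bond d (towerP L m (n + 1))) := ⟨(y, ⟨0, hd⟩)⟩
  haveI : Nonempty (TSite d (towerP L m (n + 1))) := ⟨y⟩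
  have y₀ : TSite d (towerP L m (n + 1)) := fun _ => 0
  haveI : Nonempty (Bond d m) := ⟨(v, ⟨0, hd⟩)⟩
  have hF : 0 ≤ F := (norm_nonneg _).trans (hfF (y, ⟨0, hd⟩))
  have hj₀ : 0 ≤ j₀ := (norm_nonneg _).trans (hJ ⟨0, hd⟩ y₀)
  have hAQ0 : 0 ≤ AQ := (Finset.sum_nonneg fun j _ => hα0 j).trans hAQ
  have hLpos : (0 : ℝ) < (L : ℝ) ^ (n + 1) := pow_pos (by exact_mod_cast Nat.pos_of_ne_zero (NeZero.ne L)) _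
  have hη : 0 < η := by
    by_contra h; push Not at h; nlinarith [mul_nonpos_of_nonpos_of_nonneg h hLpos.le]
  -- the enlarged radius for the owner's α-convention rows
  set α' : ℝ := max α j₀ with hα'
  have hα'0 : 0 ≤ α' := hα.trans (le_max_left _ _)
  have hαα' : α ≤ α' := le_max_left _ _
  have hα'T : α' ≤ αT := max_le hαT' hjT'
  have hUη' : ∀ b', ‖(U b' : 𝔸) - 1‖ ≤ α' * η := fun b' => (hUη b').trans (by gcongr)
  have hpl' : ∀ p : B9SectCLatticeCarrier.Plaq d (towerP L m (n + 1)), ‖(plaqHolU U p : 𝔸) - 1‖ ≤ α' * η ^ 2 := fun p => (hpl p).trans (by gcongr)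
  have hUgrad' : ∀ (x : TSite d (towerP L m (n + 1))) (μ' : Fin d), ‖(U (x, μ') : 𝔸) - U (unshift μ' x, μ')‖ ≤ α' * η ^ 2 := fun x μ' =>
    (hUgrad x μ').trans (by gcongr)
  have hεg' : ∀ j < n + 1, εU j ≤ α' * ϱ ^ j := fun j hj' => (hεg j hj').trans (mul_le_mul_of_nonneg_right hαα' (pow_nonneg hϱ0 j))
  have hJ' : ∀ (μ' : Fin d) (y' : TSite d (towerP L m (n + 1))),
      ‖B9Eq39Adjoint.J (fun μ => B9Eq33CovDerivVector.shiftEquiv μ) (fun μ y => U (y, μ)) η μ' y'‖ ≤ α' := fun μ' y' => (hJ μ' y').trans (le_max_right _ _)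
  -- the flat class data for the MODEL rows at `(fun _ => 1)`, `α := 0`
  have hαL1 : ∀ j : ℕ, 50 * (d + 1) * (fun _ : ℕ => (0 : ℝ)) j * (L : ℝ) ^ d ≤ 1 / 2 := fun _ => by norm_num
  have hUε1 : ∀ (j : ℕ) (b' : Bond d (towerP L m (j + 1))), ‖(UlevOf L m (n + 1) (fun _ : Bond d (towerP L m (n + 1)) => (1 : 𝔸ˣ)) j b' : 𝔸) - 1‖ ≤ (fun _ : ℕ => (0 : ℝ)) j :=
    fun j b' => by rw [UlevOf_one]; simp
  have hLb1 : ∀ (j : ℕ) (b' : Bond d (towerP L m (j + 1))), UlevOf L m (n + 1) (fun _ : Bond d (towerP L m (n + 1)) => (1 : 𝔸ˣ)) j b' ∈ U1 𝔸 := fun j b' => by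
    rw [UlevOf_one]; exact one_mem _
  have hRlev1 : ∀ (j : ℕ) (b' : Bond d (towerP L m (j + 1))) (w : W), ‖adTransportW φ (UlevOf L m (n + 1) (fun _ : Bond d (towerP L m (n + 1)) => (1 : 𝔸ˣ)) j) b' w‖ ≤ ‖w‖ :=
    fun j b' w => by rw [UlevOf_one, B5Eq172HodgePositivity.adTransportW_one, LinearMap.id_apply]
  have hUst1 : ∀ b' : Bond d (towerP L m (n + 1)), star ((fun _ : Bond d (towerP L m (n + 1)) => (1 : 𝔸ˣ)) b' : 𝔸) = ((((fun _ : Bond d (towerP L m (n + 1)) => (1 : 𝔸ˣ)) b')⁻¹ : 𝔸ˣ) : 𝔸) := fun _ => by simp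
  have hUb1 : ∀ b' : Bond d (towerP L m (n + 1)), (fun _ : Bond d (towerP L m (n + 1)) => (1 : 𝔸ˣ)) b' ∈ U1 𝔸 := fun _ => one_mem _
  have hUη1 : ∀ b' : Bond d (towerP L m (n + 1)), ‖(((fun _ : Bond d (towerP L m (n + 1)) => (1 : 𝔸ˣ)) b' : 𝔸ˣ) : 𝔸) - 1‖ ≤ 0 * η := fun _ => by simp
  have hpl1 : ∀ p : B9SectCLatticeCarrier.Plaq d (towerP L m (n + 1)), ‖(plaqHolU (fun _ : Bond d (towerP L m (n + 1)) => (1 : 𝔸ˣ)) p : 𝔸) - 1‖ ≤ 0 * η ^ 2 := fun _ => by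
    simp [plaqHolU_one]
  have hUgrad1 : ∀ (x : TSite d (towerP L m (n + 1))) (μ : Fin d), ‖(((fun _ : Bond d (towerP L m (n + 1)) => (1 : 𝔸ˣ)) (x, μ) : 𝔸ˣ) : 𝔸) - (fun _ : Bond d (towerP L m (n + 1)) => (1 : 𝔸ˣ)) (unshift μ x, μ)‖ ≤ 0 * η ^ 2 :=
    fun _ _ => by simp
  have hεg1 : ∀ j < n + 1, (fun _ : ℕ => (0 : ℝ)) j ≤ 0 * ϱ ^ j := fun _ _ => by simp
  have hAQ1 : ∑ j ∈ Finset.range (n + 1), (fun _ : ℕ => (0 : ℝ)) j ≤ AQ := by simpa using hAQ0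
  -- print's operator at the flat background: positivity and `G̃_k(1) = G_k(1)`
  have hposπ₁ := (laplaceAkPi_one_pos_iff L m n φ τ η a' hpos'₁ hL (fun _ => 0) (fun _ => by norm_num)
    (perCfg_UlevOf_one_mem_U1 L m (n + 1)) (norm_Wcx_UlevOf_one_sub_one_le L m (n + 1) (fun _ => 0) (fun _ => le_rfl)) a (c₀ := c₀)).mpr hpos₁
  have hQ1 := QkW_surjective L m n φ (fun _ : Bond d (towerP L m (n + 1)) => (1 : 𝔸ˣ)) hL (fun _ => 0) (fun _ => by norm_num)
    (perCfg_UlevOf_one_mem_U1 L m (n + 1)) (norm_Wcx_UlevOf_one_sub_one_le L m (n + 1) (fun _ => 0) (fun _ => le_rfl)) (c₀ := c₀) (c₁ := c₁) hαL1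
  -- the block cut-off family on the coarse sites
  obtain ⟨rr, hrr⟩ := exists_block_clm_family (𝕜 := ℂ) (w := fun _ : TSite d m => c₁) (V := W) (id : TSite d m → TSite d m)
  -- names
  set piS : TSite d (towerP L m (n + 1)) → TSite d m := fun x => blockCoord (L ^ (n + 1)) m (siteCast (towerP_eq_fineP_pow L m (n + 1)) x) with hpiS
  set piB : Bond d (towerP L m (n + 1)) → TSite d m := fun b' => piS (bpos b') with hpiB
  set Gt := G1LatticeK hposπ with hGt
  set G1 := G1k L m n φ η (fun _ : Bond d (towerP L m (n + 1)) => (1 : 𝔸ˣ)) hL (fun _ => 0) (fun _ => by norm_num)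
                (perCfg_UlevOf_one_mem_U1 L m (n + 1)) (norm_Wcx_UlevOf_one_sub_one_le L m (n + 1) (fun _ => 0) (fun _ => le_rfl)) τ (c₀ := c₀) (c₁ := c₁) hpos₁ with hG1
  set RU := RofUk L m n φ η U (c₀ := c₀) with hRU
  set R1 := RofUk L m n φ η (fun _ : Bond d (towerP L m (n + 1)) => (1 : 𝔸ˣ)) (c₀ := c₀) with hR1
  set DsU := covDivL2K ℂ c₀ ((η : ℂ))⁻¹ (adTransportW φ fun bb => (U bb)⁻¹) with hDsU
  set Ds1 := covDivL2K ℂ c₀ ((η : ℂ))⁻¹ (adTransportW φ fun bb => ((fun _ : Bond d (towerP L m (n + 1)) => (1 : 𝔸ˣ)) bb)⁻¹) with hDs1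
  -- the CLMs
  obtain ⟨TdG, hTdG⟩ : ∃ T : BondL2K ℂ d (towerP L m (n + 1)) c₀ W →L[ℂ] SiteL2K ℂ d (towerP L m (n + 1)) c₀ W, T = LinearMap.toContinuousLinearMap (DsU ∘ₗ Gt) := ⟨_, rfl⟩
  obtain ⟨TdD, hTdD⟩ : ∃ T : BondL2K ℂ d (towerP L m (n + 1)) c₀ W →L[ℂ] SiteL2K ℂ d (towerP L m (n + 1)) c₀ W, T = LinearMap.toContinuousLinearMap (DsU ∘ₗ (Gt - G1)) :=
    ⟨_, rfl⟩
  obtain ⟨TWd, hTWd⟩ : ∃ T : BondL2K ℂ d (towerP L m (n + 1)) c₀ W →L[ℂ] SiteL2K ℂ d (towerP L m (n + 1)) c₀ W, T = LinearMap.toContinuousLinearMap (DsU ∘ₗ G1 - Ds1 ∘ₗ G1) :=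
    ⟨_, rfl⟩
  obtain ⟨TRd, hTRd⟩ : ∃ T : SiteL2K ℂ d (towerP L m (n + 1)) c₀ W →L[ℂ] SiteL2K ℂ d (towerP L m (n + 1)) c₀ W, T = LinearMap.toContinuousLinearMap (RU - R1) := ⟨_, rfl⟩
  obtain ⟨TR1, hTR1⟩ : ∃ T : SiteL2K ℂ d (towerP L m (n + 1)) c₀ W →L[ℂ] SiteL2K ℂ d (towerP L m (n + 1)) c₀ W, T = LinearMap.toContinuousLinearMap R1 := ⟨_, rfl⟩
  -- (1) the letters at the common rate `κ₀`
  have hweak : ∀ {r' : ℝ} (t : ℝ), κ₀ ≤ r' → 0 ≤ t → Real.exp (-(r' * t)) ≤ Real.exp (-(κ₀ * t)) := fun t hr ht => Real.exp_le_exp.mpr (by nlinarith)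
  -- (L)(D*_UG̃_k(U); BT, κ₀): the divergence row of (T4B) at the radius `α′`
  have hLdG : ∀ (w : TSite d m) (g : BondL2K ℂ d (towerP L m (n + 1)) c₀ W) (G : ℝ), (∀ x, piB x ≠ w → WL2.equiv ℂ (fun _ : Bond d (towerP L m (n + 1)) => c₀) W g x = 0) →
      (∀ x, ‖WL2.equiv ℂ (fun _ : Bond d (towerP L m (n + 1)) => c₀) W g x‖ ≤ G) → ∀ x, ‖WL2.equiv ℂ (fun _ : TSite d (towerP L m (n + 1)) => c₀) W (TdG g) x‖ ≤ BT * Real.exp (-(κ₀ * tdist m (piS x) w)) * G := by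
    intro w g G hgv hgG x
    have hG : 0 ≤ G := (norm_nonneg _).trans (hgG (y, ⟨0, hd⟩))
    rw [hTdG, LinearMap.coe_toContinuousLinearMap', LinearMap.comp_apply]
    refine ((HT n η hηL c₀ c₁ hw hρ m hm U αU hα0 hα1 hU1 hreg εU hεU hUε hLb α' hα'0 hα'T hUst hUb hUη' hpl' hUgrad' hRlev hεg' hAQ hpos' hpos hposπ hc₀η hJ'
      w g G hgv hgG ⟨0, hd⟩ (y, ⟨0, hd⟩) x).2.1).trans ?_
    exact mul_le_mul_of_nonneg_right (mul_le_mul_of_nonneg_left (hweak _ hκ₀T (tdist_nonneg m _ _)) hBT) hG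
  -- (L)(R_k(U) − R_k(1); KR′·α, κ₀): the ladder majorant read back
  have hTR := HR n η hηL c₀ c₁ hw hρ m hm U α hα hαR' hUb hUη hUw hpl hUst αU hα1 hU1 hreg εU hεU hε1 hεg hUε hLb hRlev hpos' hpos'₁ rr hrr 0 0 True
  rw [← conj_sub, ← readA_sub] at hTR
  have hLRd : ∀ (w : TSite d m) (h : SiteL2K ℂ d (towerP L m (n + 1)) c₀ W) (H : ℝ), (∀ x, piS x ≠ w → WL2.equiv ℂ (fun _ : TSite d (towerP L m (n + 1)) => c₀) W h x = 0) →
      (∀ x, ‖WL2.equiv ℂ (fun _ : TSite d (towerP L m (n + 1)) => c₀) W h x‖ ≤ H) → ∀ x, ‖WL2.equiv ℂ (fun _ : TSite d (towerP L m (n + 1)) => c₀) W (TRd h) x‖ ≤ (KR' * α) * Real.exp (-(κ₀ * tdist m (piS x) w)) * H := by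
    intro w h H hhv hhH x
    have hH : 0 ≤ H := (norm_nonneg _).trans (hhH x)
    have hoff' : ∀ x', blkK L m n x' ≠ w → WL2.equiv ℂ (fun _ : TSite d (towerP L m (n + 1)) => c₀) W h x' = 0 := fun x' hx' =>
      hhv x' (by rw [blkK_eq_blockCoord_siteCast] at hx'; exact hx')
    have hbd' : ∀ x', blkK L m n x' = w → ‖WL2.equiv ℂ (fun _ : TSite d (towerP L m (n + 1)) => c₀) W h x'‖ ≤ H := fun x' _ => hhH x'
    have hrow := blockRowW_of_hasMajorant_conj_readA φ hMφ hMφ' hφ hφ' b hM₂ hrepr (G := toB6 (towerGeom L m n η 0) 0 True) (blkK L m n) _ _ hTR w h H hH hoff' hbd' x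
    rw [hTRd, LinearMap.coe_toContinuousLinearMap']
    refine hrow.trans ?_
    have hexp : Real.exp (-(δR * (towerGeom L m n η 0).dist (blkK L m n x) w)) ≤ Real.exp (-(κ₀ * tdist m (piS x) w)) := by
      rw [dist_towerGeom, blkK_eq_blockCoord_siteCast]
      refine Real.exp_le_exp.mpr ?_
      have h1 := tdist_le_tdist1 (blockCoord (L ^ (n + 1)) m (siteCast (towerP_eq_fineP_pow L m (n + 1)) x)) w
      have h2 := tdist_nonneg m (blockCoord (L ^ (n + 1)) m (siteCast (towerP_eq_fineP_pow L m (n + 1)) x)) w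
      nlinarith [mul_le_mul_of_nonneg_right hκ₀R h2, mul_le_mul_of_nonneg_left h1 hδR.le]
    calc Mφ' * Mφ * ((∑ i, ‖b i‖) * M₂ * (KR * α * Real.exp (-(δR * (towerGeom L m n η 0).dist (blkK L m n x) w)))) * H
        ≤ Mφ' * Mφ * ((∑ i, ‖b i‖) * M₂ * (KR * α * Real.exp (-(κ₀ * tdist m (piS x) w)))) * H := by gcongr
      _ = (KR' * α) * Real.exp (-(κ₀ * tdist m (piS x) w)) * H := by rw [hKR']; ring
  -- (L)(D*_U(G̃_k(U) − G_k(1)); (j₀+α)·KD, κ₀): the `∇_U` letter of gen 101 read as a divergence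
  have hSR : ∀ (b' : Bond d (towerP L m (n + 1))) (w : W), adTransportW φ (fun bb => (U bb)⁻¹) b' (adTransportW φ U b' w) = w := fun b' w => by
    rw [B9Eq310HessianOperator.adTransportW_apply, B9Eq310HessianOperator.adTransportW_apply, LinearEquiv.apply_symm_apply, inv_inv]
    have h : (((U b')⁻¹ : 𝔸ˣ) : 𝔸) * ((U b' : 𝔸) * φ w * ((U b')⁻¹ : 𝔸ˣ)) * (U b' : 𝔸) = φ w := by
      rw [← mul_assoc, ← mul_assoc, Units.inv_mul, one_mul, mul_assoc, Units.inv_mul, mul_one]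
    rw [h, LinearEquiv.symm_apply_apply]
  have hLdD : ∀ (w : TSite d m) (g : BondL2K ℂ d (towerP L m (n + 1)) c₀ W) (G : ℝ), (∀ x, piB x ≠ w → WL2.equiv ℂ (fun _ : Bond d (towerP L m (n + 1)) => c₀) W g x = 0) →
      (∀ x, ‖WL2.equiv ℂ (fun _ : Bond d (towerP L m (n + 1)) => c₀) W g x‖ ≤ G) → ∀ x, ‖WL2.equiv ℂ (fun _ : TSite d (towerP L m (n + 1)) => c₀) W (TdD g) x‖ ≤ ((j₀ + α) * KD) * Real.exp (-(κ₀ * tdist m (piS x) w)) * G := by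
    intro w g G hgv hgG x
    have hG : 0 ≤ G := (norm_nonneg _).trans (hgG (y, ⟨0, hd⟩))
    rw [hTdD, LinearMap.coe_toContinuousLinearMap', LinearMap.comp_apply, equiv_covDivL2K,
      covDiv_eq_neg_sum_covGrad ((η : ℂ))⁻¹ (adTransportW φ U) (adTransportW φ fun bb => (U bb)⁻¹) hSR, norm_neg]
    refine (norm_sum_le _ _).trans ?_
    have hterm : ∀ μ : Fin d, ‖adTransportW φ (fun bb => (U bb)⁻¹) (unshift μ x, μ)
        (covGrad ((η : ℂ))⁻¹ (adTransportW φ U) (WL2.equiv ℂ (fun _ : Bond d (towerP L m (n + 1)) => c₀) W ((Gt - G1) g)) ((unshift μ x, μ), μ))‖ ≤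
        (Mφ * Mφ') * ((j₀ + α) * KP * Real.exp (-(κ₀ * tdist m (piS x) w)) * G) := by
      intro μ
      refine (norm_adTransportW_le φ hφ hφ' hMφ' (fun bb => (U bb)⁻¹) (unshift μ x, μ) ((U1 𝔸).inv_mem (hUb _)) _).trans ?_
      refine mul_le_mul_of_nonneg_left ?_ (mul_nonneg hMφ hMφ')
      have h := (HP n η hηL c₀ c₁ hw hρ m hm U αU hα0 hα1 hαL hU1 hreg εU hεU hε1 hUε hLb α hα hαP' hUst hUb hUη hUw hpl hUgrad hRlev hεg hAQ hpos' hpos hc₀η j₀ hJ hjP'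
        hposπ hQ hpos'₁ hpos₁ w g G hgv hgG μ (unshift μ x, μ)).2.1
      rw [LinearMap.sub_apply]
      refine h.trans ?_
      have hb : tdist m (blockCoord (L ^ (n + 1)) m (siteCast (towerP_eq_fineP_pow L m (n + 1)) (btgt (unshift μ x, μ)))) w = tdist m (piS x) w := by
        simp only [btgt, shift_unshift, hpiS]
      rw [hb]
      exact mul_le_mul_of_nonneg_right (mul_le_mul_of_nonneg_left (hweak _ hκ₀P (tdist_nonneg m _ _)) (mul_nonneg (add_nonneg hj₀ hα) hKP)) hG
    refine (Finset.sum_le_sum fun μ _ => hterm μ).trans ?_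
    rw [Finset.sum_const, Finset.card_univ, Fintype.card_fin, nsmul_eq_mul, hKD]
    exact le_of_eq (by ring)
  -- (L)((D*_U − D*_1)G_k(1); KW·α, κ₀)
  have hLWd : ∀ (w : TSite d m) (g : BondL2K ℂ d (towerP L m (n + 1)) c₀ W) (G : ℝ), (∀ x, piB x ≠ w → WL2.equiv ℂ (fun _ : Bond d (towerP L m (n + 1)) => c₀) W g x = 0) →
      (∀ x, ‖WL2.equiv ℂ (fun _ : Bond d (towerP L m (n + 1)) => c₀) W g x‖ ≤ G) → ∀ x, ‖WL2.equiv ℂ (fun _ : TSite d (towerP L m (n + 1)) => c₀) W (TWd g) x‖ ≤ (KW * α) * Real.exp (-(κ₀ * tdist m (piS x) w)) * G := by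
    intro w g G hgv hgG x
    have hG : 0 ≤ G := (norm_nonneg _).trans (hgG (y, ⟨0, hd⟩))
    rw [hTWd, LinearMap.coe_toContinuousLinearMap', LinearMap.sub_apply, LinearMap.comp_apply, LinearMap.comp_apply, WL2.equiv_sub, Pi.sub_apply]
    refine ((HW n η hηL c₀ c₁ hw hρ m hm U α hα hαW' hUb hUη hUw hpl hpos'₁ hpos₁ w g G hgv hgG x).2).trans ?_
    exact mul_le_mul_of_nonneg_right (mul_le_mul_of_nonneg_left (hweak _ hκ₀W (tdist_nonneg m _ _)) (mul_nonneg hKW hα)) hG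
  -- (L)(R_k(1); BO, κ₀): ne9-leaf-05's letter at the vacuum
  have hLR1 : ∀ (w : TSite d m) (h : SiteL2K ℂ d (towerP L m (n + 1)) c₀ W) (H : ℝ), (∀ x, piS x ≠ w → WL2.equiv ℂ (fun _ : TSite d (towerP L m (n + 1)) => c₀) W h x = 0) →
      (∀ x, ‖WL2.equiv ℂ (fun _ : TSite d (towerP L m (n + 1)) => c₀) W h x‖ ≤ H) → ∀ x, ‖WL2.equiv ℂ (fun _ : TSite d (towerP L m (n + 1)) => c₀) W (TR1 h) x‖ ≤ BO * Real.exp (-(κ₀ * tdist m (piS x) w)) * H := by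
    intro w h H hhv hhH x
    have hH : 0 ≤ H := (norm_nonneg _).trans (hhH x)
    rw [hTR1, LinearMap.coe_toContinuousLinearMap']
    refine ((HO n η hηL c₀ c₁ hw hρ m hm (fun _ : Bond d (towerP L m (n + 1)) => (1 : 𝔸ˣ)) (fun _ => 0) (fun _ => le_rfl) (fun _ => by norm_num)
      (perCfg_UlevOf_one_mem_U1 L m (n + 1)) (norm_Wcx_UlevOf_one_sub_one_le L m (n + 1) (fun _ => 0) (fun _ => le_rfl)) (fun _ => 0) (fun _ => le_rfl) hUε1 hLb1
      0 le_rfl hαO.le hUst1 hUb1 hUη1 hpl1 hUgrad1 hRlev1 hεg1 hAQ1 hpos'₁ w h H hhv hhH x).2.1).trans ?_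
    exact mul_le_mul_of_nonneg_right (mul_le_mul_of_nonneg_left (hweak _ hκ₀O (tdist_nonneg m _ _)) hBO) hH
  -- (2) the three words
  have hrow : ∀ w : TSite d m, ∑ u, Real.exp (-((κ₀ - κ₀ / 2) * tdist m w u)) ≤ S := fun w => by
    rw [show κ₀ - κ₀ / 2 = κ₀ / 2 by ring]; exact torusSum_le d hm (half_pos hκ₀0) w
  have hδ0 : ∀ u v : TSite d m, 0 ≤ tdist m u v := fun u v => tdist_nonneg _ _ _
  have hδt : ∀ u y v : TSite d m, tdist m u v ≤ tdist m u y + tdist m y v := fun u y v => tdist_triangle hm u y v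
  have hκ'0 : (0 : ℝ) ≤ κ₀ / 2 := by positivity
  have hκ'1 : κ₀ / 2 ≤ κ₀ := by linarith
  have hW1 := letter_comp (𝕜 := ℂ) (tdist m) piB piS piS TdG TRd hδ0 hδt hBT (mul_nonneg hKR'0 hα) hκ'0 hκ'1 hLdG hLRd hrow
  have hW2 := letter_comp (𝕜 := ℂ) (tdist m) piB piS piS TdD TR1 hδ0 hδt (mul_nonneg (add_nonneg hj₀ hα) hKD0) hBO hκ'0 hκ'1 hLdD hLR1 hrow
  have hW3 := letter_comp (𝕜 := ℂ) (tdist m) piB piS piS TWd TR1 hδ0 hδt (mul_nonneg hKW hα) hBO hκ'0 hκ'1 hLWd hLR1 hrow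
  have hW12 := letter_add (𝕜 := ℂ) (tdist m) piB piS _ _ hW1 hW2
  have hW := letter_add (𝕜 := ℂ) (tdist m) piB piS _ _ hW12 hW3 v f F hfv hfF y
  -- (3) (3.152) at `U` and at `1`, `G̃_k(1) = G_k(1)`, and the telescoping identity
  have e1 := RofUk_covDivL2K_G1LatticeKPi L m n φ τ hτ₁ hτ₂ hφτ η U hUst a' hpos' hL αU hα1 hU1 hreg a hposπ f
  have e2 := RofUk_covDivL2K_G1LatticeKPi L m n φ τ hτ₁ hτ₂ hφτ η (fun _ : Bond d (towerP L m (n + 1)) => (1 : 𝔸ˣ)) hUst1 a' hpos'₁ hL (fun _ => 0) (fun _ => by norm_num)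
    (perCfg_UlevOf_one_mem_U1 L m (n + 1)) (norm_Wcx_UlevOf_one_sub_one_le L m (n + 1) (fun _ => 0) (fun _ => le_rfl)) a hposπ₁ f
  have e3 : G1LatticeK hposπ₁ = G1 :=
    (letters_laplaceAkPi_one L m n φ τ η a' hpos'₁ hL (fun _ => 0) (fun _ => by norm_num)
      (perCfg_UlevOf_one_mem_U1 L m (n + 1)) (norm_Wcx_UlevOf_one_sub_one_le L m (n + 1) (fun _ => 0) (fun _ => le_rfl)) a hposπ₁ hpos₁ hQ1).1
  rw [e3] at e2
  rw [← e1, ← e2]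
  have hsplit : RU (DsU (Gt f)) - R1 (Ds1 (G1 f)) = (((TRd ∘L TdG) + (TR1 ∘L TdD)) + (TR1 ∘L TWd)) f := by
    simp only [add_apply, ContinuousLinearMap.coe_comp, Function.comp_apply]
    rw [hTRd, hTR1, hTdG, hTdD, hTWd]
    simp only [LinearMap.coe_toContinuousLinearMap']
    simp only [LinearMap.sub_apply, LinearMap.comp_apply, map_sub]
    abel
  rw [hsplit]
  refine hW.trans ?_
  -- (4) the constants
  set E : ℝ := Real.exp (-(κ₀ / 2 * tdist m (piS y) v)) with hE
  have hE0 : 0 ≤ E := Real.exp_nonneg _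
  have hX1 : 0 ≤ BT * KR' * S := by positivity
  have hX3 : 0 ≤ KW * BO * S := by positivity
  have h1 : BT * (KR' * α) * S ≤ (j₀ + α) * (BT * KR' * S) := by
    have e : BT * (KR' * α) * S = α * (BT * KR' * S) := by ring
    rw [e]; nlinarith [mul_nonneg hj₀ hX1]
  have h2 : (j₀ + α) * KD * BO * S = (j₀ + α) * (KD * BO * S) := by ring
  have h3 : KW * α * BO * S ≤ (j₀ + α) * (KW * BO * S) := by
    have e : KW * α * BO * S = α * (KW * BO * S) := by ring
    rw [e]; nlinarith [mul_nonneg hj₀ hX3]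
  have hKexp : (j₀ + α) * K = (j₀ + α) * (BT * KR' * S) + (j₀ + α) * (KD * BO * S) + (j₀ + α) * (KW * BO * S) := by rw [hK]; ring
  have hsum : BT * (KR' * α) * S + (j₀ + α) * KD * BO * S + KW * α * BO * S ≤ (j₀ + α) * K := by rw [hKexp, h2]; linarith
  exact mul_le_mul_of_nonneg_right (mul_le_mul_of_nonneg_right hsum hE0) hF

end Literature.MathematicalPhysics.QuantumFieldTheory.Balaban1983to89.B9Eq3152RkGpDstarPiTwoBackgroundLetterTower

end
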